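import Summits.ResolutionOfSingularities.ResolutionOfSingularities.Theorems.FrobeniusClosingSteerLowTowerTorsor
import Summits.ResolutionOfSingularities.ResolutionOfSingularities.Theorems.FrobeniusClosingSteerLowTowerMoves
import Summits.ResolutionOfSingularities.ResolutionOfSingularities.Theorems.FrobeniusClosingSteerLowStageSingular
import HarnessLib

/-!
# Steer σ-residual, LOW half — D3d over the LOW tower: every torsor ring `A[T] ⊆ L` of the tower is SINGULAR

OURS (campaign res-hironaka, rung L ★L-G4, slot W4.1, crux `Steer` stmt-ResolutionOfSingularities-16345; res-L0-w41-plan-1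
RULING 18d «D3d = res-L0-w41-stub-3», RULING 38a (D3a parts 1+2 landed: res-D-pv-012's `…LowTowerMoves` / `…LowTowerTorsor`);
replaces the role of no printed item; NOT a statement of the manuscript under review [claim: Hironaka2017, status: under-review];
AI review is weaker than expert review). Theses-free, definition-free.

The clause `∀ n, ¬ IsRegularLocalRing (Y n)` of the LOW Prop `LowRunTamedMixedBranchTwo` (§σ2.23), for res-D-pv-012's CONCRETE
torsor rings `Y = A[T] = Subring.closure (insert T A) ⊆ L` (`T² = h ∈ A`, `A = φ(R)` the critical-surface germ of a member `R` of
the run, read in one field `L ⊇ κ(P₀)`), glued to the presentation-agnostic core `…LowStageSingular` (p516250/p517042):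

* `not_isRegularLocalRing_closure_insert` — TORSOR LEVEL: `A ⊆ L` a REGULAR local subring of characteristic `2`, `T² = h ∈ A`,
  `h ≡ c²` modulo `𝔪_A²`, `h` not the square of a fraction of `A` ⇒ `A[T]` is not a regular local ring
  (`closure_insert_eq_lift_range` + 026's `lift_injective_of_forall_pow_ne` give `A[T] ≃+* A[X]/(X² − h)`; then res-type-082's
  criterion via `LowStageSingular.not_isRegularLocalRing_of_ringEquiv_adjoinRoot`);
* `not_isRegularLocalRing_closure_insert_map` — MEMBER LEVEL, in the `…LowTowerMoves` vocabulary `A = (R.comap Λ.subtype).map φ`: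
  the witness `f − g² ∈ 𝔪_R²` descends along the surjection `R ↠ φ(R)` (`exists_surjective_restrict`);
* `steeredStage_torsor_singular` — RUN LEVEL: at every stage of a σ_top-steered run whose member is regular the radicand is a square
  to second order (`LowStageSingular.steeredStage_singular`), hence the torsor ring over the (regular) surface germ is singular;
* `not_isRegularLocalRing_of_toSubring_eq` — transport to a `k`-subalgebra `Y` with `Y.toSubring = A[T]` (the §σ2.23 frame speaks
  `Y : ℕ → Subalgebra k L′`).

Regularity of the surface germ `φ(R n)` is the assembler's input (C2 `CriticalSurface.criticalSurface`: `R ⧸ P₀` regular; C5 followed);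
`hnr` is `…LowTowerTorsor`'s own binder (torsor generator not a fraction of the germ). [cite: Matsumura1987, Thm. 14.2] [folklore]
-/

noncomputable section

-- single-problem summit: the doubled namespace component `ResolutionOfSingularities` is forced
set_option linter.dupNamespace false

namespace Summit.ResolutionOfSingularities.ResolutionOfSingularities.Theorems.SwitchingDichotomy.LowTower

open IsLocalRing Polynomial
open Literature.AlgebraicGeometry.Resolution
open Summit.ResolutionOfSingularities.ResolutionOfSingularities.Theorems.SwitchingDichotomy

variable {L : Type} [Field L]

/-! ## Torsor level -/

/-- **The torsor ring is the radicand ring**: for `T² = h ∈ A ⊆ L` with `h` not the square of a fraction of `A`, the map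
`A[X]/(X² − h) → L`, `X ↦ T`, is an isomorphism onto `A[T] = closure (A ∪ {T})` (res-D-pv-012's `closure_insert_eq_lift_range` +
res-type-026's `RadicandChainRealisation.lift_injective_of_forall_pow_ne`). [folklore] -/
theorem nonempty_ringEquiv_closure_insert_adjoinRoot (A : Subring L) {T h : L} (hh : h ∈ A) (hT : T ^ 2 = h)
    (hnr : ∀ u v : A, (v : L) ≠ 0 → ((u : L) / (v : L)) ^ 2 ≠ h) :
    Nonempty (Subring.closure (insert T (A : Set L)) ≃+* AdjoinRoot ((X : A[X]) ^ 2 - C (⟨h, hh⟩ : A))) := by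
  haveI : Fact (Nat.Prime 2) := ⟨Nat.prime_two⟩
  have h0 := eval₂_sq_sub_eq_zero A hh hT
  have hinj : Function.Injective (AdjoinRoot.lift A.subtype T h0) :=
    RadicandChainRealisation.lift_injective_of_forall_pow_ne A.subtype Subtype.coe_injective ⟨h, hh⟩ T hT
      (fun u v hv => hnr u v hv) h0
  rw [closure_insert_eq_lift_range A hh hT]
  exact ⟨(RingEquiv.ofBijective (AdjoinRoot.lift A.subtype T h0).rangeRestrict
    ⟨fun a b hab => hinj (congrArg Subtype.val hab), RingHom.rangeRestrict_surjective _⟩).symm⟩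

/-- **D3d, torsor level.** Let `A ⊆ L` be a REGULAR local subring of a field of characteristic `2`, `T ∈ L` with `T² = h ∈ A`,
`h − c² ∈ 𝔪_A²` for some `c ∈ A` (the radicand is a square to second order — along a steered run: σ_top moves only at squares),
and `h` not the square of a fraction of `A`. Then the torsor ring `A[T] = closure (A ∪ {T})` is NOT a regular local ring.
[cite: Matsumura1987, Thm. 14.2] -/
theorem not_isRegularLocalRing_closure_insert [CharP L 2] (A : Subring L) [IsRegularLocalRing A] {T h : L}
    (hh : h ∈ A) (hT : T ^ 2 = h) (hsq : ∃ c : A, (⟨h, hh⟩ : A) - c ^ 2 ∈ maximalIdeal A ^ 2)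
    (hnr : ∀ u v : A, (v : L) ≠ 0 → ((u : L) / (v : L)) ^ 2 ≠ h) :
    ¬ IsRegularLocalRing (Subring.closure (insert T (A : Set L))) := by
  haveI : Fact (Nat.Prime 2) := ⟨Nat.prime_two⟩
  haveI : CharP A 2 := inferInstance
  obtain ⟨e⟩ := nonempty_ringEquiv_closure_insert_adjoinRoot A hh hT hnr
  exact LowStageSingular.not_isRegularLocalRing_of_ringEquiv_adjoinRoot 2 (⟨h, hh⟩ : A) hsq e

/-- The same with the second-order witness given in the field: `h − c² = m` with `c ∈ A` and `m ∈ 𝔪_A²` read in `L`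
(convenience form for assemblers holding the LOW shape `h − ḡ² = ē₁ē₂ + c̄`). [cite: Matsumura1987, Thm. 14.2] -/
theorem not_isRegularLocalRing_closure_insert' [CharP L 2] (A : Subring L) [IsRegularLocalRing A] {T h c : L}
    (hh : h ∈ A) (hT : T ^ 2 = h) (hc : c ∈ A)
    (hsq : (⟨h - c ^ 2, A.sub_mem hh (A.pow_mem hc 2)⟩ : A) ∈ maximalIdeal A ^ 2)
    (hnr : ∀ u v : A, (v : L) ≠ 0 → ((u : L) / (v : L)) ^ 2 ≠ h) :
    ¬ IsRegularLocalRing (Subring.closure (insert T (A : Set L))) :=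
  not_isRegularLocalRing_closure_insert A hh hT ⟨⟨c, hc⟩, by
    have : (⟨h, hh⟩ : A) - (⟨c, hc⟩ : A) ^ 2 = ⟨h - c ^ 2, A.sub_mem hh (A.pow_mem hc 2)⟩ := Subtype.ext rfl
    rw [this]; exact hsq⟩ hnr

/-- **Transport to the `k`-subalgebra frame**: if `Y : Subalgebra k L` has underlying subring `A[T]`, then `Y` is not a regular
local ring either (the §σ2.23 Prop `LowRunTamedMixedBranchTwo` speaks `Y : ℕ → Subalgebra k L′`). [folklore] -/
theorem not_isRegularLocalRing_of_toSubring_eq {k : Type} [Field k] [Algebra k L] (Y : Subalgebra k L) (S : Subring L)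
    (hY : Y.toSubring = S) (hS : ¬ IsRegularLocalRing S) : ¬ IsRegularLocalRing Y := by
  intro hreg
  apply hS
  haveI := hreg
  subst hY
  exact IsRegularLocalRing.of_ringEquiv (RingEquiv.refl Y)

/-! ## Member level (vocabulary of `…LowTowerMoves`: `A = φ(R) = (R.comap Λ.subtype).map φ`) -/

variable {K : Type} [Field K]

/-- **D3d, member level.** `Λ ≤ K` a subring with a ring map `φ : Λ → L` (the residue map at the generic point of the critical
surface followed by `κ(P₀) ⊆ L`), `R ≤ Λ` a LOCAL member whose surface germ `φ(R) ⊆ L` is a REGULAR local ring (C2 + C5), `f ∈ R`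
a radicand with `f − g² ∈ 𝔪_R²`, `T² = φ f`, and `φ f` not the square of a fraction of `φ(R)`. Then the torsor ring `φ(R)[T]` is
NOT a regular local ring: the witness descends along the surjection `R ↠ φ(R)`. [cite: Matsumura1987, Thm. 14.2] -/
theorem not_isRegularLocalRing_closure_insert_map [CharP L 2] (Λ : Subring K) (φ : Λ →+* L) (R : Subring K)
    [IsLocalRing R] (hR : R ≤ Λ) (hA : IsRegularLocalRing ((R.comap Λ.subtype).map φ))
    {f : K} (hf : f ∈ R) (hsq : ∃ g : R, (⟨f, hf⟩ : R) - g ^ 2 ∈ maximalIdeal R ^ 2)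
    {T : L} (hT : T ^ 2 = φ ⟨f, hR hf⟩)
    (hnr : ∀ u v : (R.comap Λ.subtype).map φ, (v : L) ≠ 0 → ((u : L) / (v : L)) ^ 2 ≠ φ ⟨f, hR hf⟩) :
    ¬ IsRegularLocalRing (Subring.closure (insert T (((R.comap Λ.subtype).map φ : Subring L) : Set L))) := by
  haveI := hA
  obtain ⟨ψ, hψ, hψval⟩ := exists_surjective_restrict Λ φ R hR
  have hmem : φ ⟨f, hR hf⟩ ∈ (R.comap Λ.subtype).map φ :=
    (mem_map_comap_iff Λ φ R _).mpr ⟨⟨f, hR hf⟩, hf, rfl⟩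
  have hψf : ψ ⟨f, hf⟩ = ⟨φ ⟨f, hR hf⟩, hmem⟩ := Subtype.ext (hψval ⟨f, hf⟩)
  have hsq' : ∃ c : (R.comap Λ.subtype).map φ,
      (⟨φ ⟨f, hR hf⟩, hmem⟩ : (R.comap Λ.subtype).map φ) - c ^ 2 ∈
        maximalIdeal ((R.comap Λ.subtype).map φ) ^ 2 := by
    rw [← hψf]
    exact LowStageSingular.exists_sub_pow_mem_sq_map ψ (fun m hm => by
      rw [← IsLocalRing.map_maximalIdeal_of_surjective ψ hψ]; exact Ideal.mem_map_of_mem ψ hm) hsq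
  exact not_isRegularLocalRing_closure_insert _ hmem hT hsq' hnr

/-! ## Run level: every torsor ring of the LOW tower of a steered run is singular -/

/-- **D3d, run level.** Along a σ_top-STEERED run in characteristic `2` (abstract permissibility predicate `Perm` of which only
«`Perm S f P → P ≠ 𝔪 ∧ P` prime `∧ ∃ g, f − g² ∈ P²`» is consumed; run clause as in `LowStageSingular.steeredStage_singular`),
at every stage `i` whose member `R i` is regular and lies in `Λ`, with REGULAR surface germ `φ(R i)` and torsor generator
`T² = φ(s_i²)` not the square of a fraction of `φ(R i)`, the torsor ring `φ(R i)[T] ⊆ L` is NOT a regular local ring: the steered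
centre forces `s_i² − g² ∈ 𝔪ᵢ²` (σ_top moves only at squares to second order), which descends to the germ.
[cite: Matsumura1987, Thm. 14.2] [folklore] -/
theorem steeredStage_torsor_singular [CharP K 2] [CharP L 2]
    (Perm : ∀ S : Subring K, IsLocalRing S → S → Ideal S → Prop)
    (hPerm : ∀ (S : Subring K) (hS : IsLocalRing S) (f : S) (P : Ideal S),
      Perm S hS f P → P ≠ maximalIdeal S ∧ P.IsPrime ∧ ∃ g : S, f - g ^ 2 ∈ P ^ 2)
    (O : ValuationSubring K) (R : ℕ → Subring K) (P : (i : ℕ) → Ideal (R i)) (s : ℕ → K)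
    (hrun : ∀ i, ∃ (hL : IsLocalRing (R i)) (hs : s i ^ 2 ∈ R i),
      (Perm (R i) hL ⟨s i ^ 2, hs⟩ (P i) ∨
        (P i = maximalIdeal (R i) ∧ (∀ Q : Ideal (R i), ¬ Perm (R i) hL ⟨s i ^ 2, hs⟩ Q) ∧
          ∃ g : R i, (⟨s i ^ 2, hs⟩ : R i) - g ^ 2 ∈ maximalIdeal (R i) ^ 2)) ∧
      IsLocalBlowupAlong O (R i) (P i) (R (i + 1)) ∧
      ∃ x g : K, ((∃ hx : x ∈ R i, (⟨x, hx⟩ : R i) ∈ P i) ∧ x ≠ 0 ∧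
        ∀ y : R i, y ∈ P i → O.valuation (y : K) ≤ O.valuation x) ∧ g ∈ R i ∧
        s i = x * s (i + 1) + g)
    (Λ : Subring K) (φ : Λ →+* L) (i : ℕ) (hreg : IsRegularLocalRing (R i)) (hRΛ : R i ≤ Λ)
    (hA : IsRegularLocalRing (((R i).comap Λ.subtype).map φ))
    {T : L} (hT : T ^ 2 = φ ⟨s i ^ 2, hRΛ (hrun i).2.1⟩)
    (hnr : ∀ u v : ((R i).comap Λ.subtype).map φ, (v : L) ≠ 0 →
      ((u : L) / (v : L)) ^ 2 ≠ φ ⟨s i ^ 2, hRΛ (hrun i).2.1⟩) :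
    ¬ IsRegularLocalRing (Subring.closure (insert T ((((R i).comap Λ.subtype).map φ : Subring L) : Set L))) := by
  haveI : Fact (Nat.Prime 2) := ⟨Nat.prime_two⟩
  obtain ⟨_, hs, hsq, -⟩ := LowStageSingular.steeredStage_singular 2 Perm hPerm O R P s hrun i hreg
  haveI : IsLocalRing (R i) := (hrun i).1
  exact not_isRegularLocalRing_closure_insert_map Λ φ (R i) hRΛ hA hs hsq hT hnr

end Summit.ResolutionOfSingularities.ResolutionOfSingularities.Theorems.SwitchingDichotomy.LowTower

end
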